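import Mathlib
import Summits.ValiantsHypothesis.ValiantsHypothesis.Theorems.LacunarySymmetroidMatrixDescartesOsculationLawGPDensityFrame
import Summits.ValiantsHypothesis.ValiantsHypothesis.Theorems.LacunarySymmetroidMatrixDescartesOsculationLawGPDensityShift
import Summits.ValiantsHypothesis.ValiantsHypothesis.Theorems.LacunarySymmetroidMatrixDescartesOsculationLawGPDensityDet
import Summits.ValiantsHypothesis.ValiantsHypothesis.Theorems.LacunarySymmetroidMatrixDescartesOsculationLawGPDensityOsc
import Summits.ValiantsHypothesis.ValiantsHypothesis.Theorems.LacunarySymmetroidMatrixDescartesOsculationLawGPWitnessGeneric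
import Summits.ValiantsHypothesis.ValiantsHypothesis.Theorems.LacunarySymmetroidMatrixDescartesOsculationLawRecursionWitness
import Summits.ValiantsHypothesis.ValiantsHypothesis.Theorems.LacunarySymmetroidMatrixDescartesOsculationLawRecursionAssemblyPrime

/-!
# `MatrixDescartes` (stmt-ValiantsHypothesis-18050), line `osculation_law`, stub `stub_recursion` — (7′b) THE DENSITY OF THE
# HEREDITARY UNIFORM-SHIFT NODE FAMILY, modulo the two arc-avoidance providers, and the by-name closer of `stub_recursion`

Helper file (`--supports stmt-ValiantsHypothesis-18050 --as helper`; cell val-lit, seat val-port-3 g1 = assembler of record,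
merged desk RULING #287 (ROUTE′ adopted)).  Closes NO item by itself.  0 defs.

Assembly of the ROUTE′ density `hGP′` of `RecursionTransfer.recursion_of_gpNodeDensePrime` from the tree's providers:
the generic diagonal WITNESS (`OsculationGeneric.exists_generic_diagonal_witness'`, val-lit-p6 g14), its structural node
CERTIFICATES at every level (`OsculationRecursion.node_certificates`, val-lit-p4 g13), the UNIFORM SHIFT
(`GPDensity.exists_uniform_split_segment`), the (D1) providers `OsculationGeneric.det0_cofinite` / `det1_cofinite`
(val-lit-p6 g14), the (D2) providers `OsculationUniform.fin0_cofinite` / `fin1_cofinite` (val-lit-p5 g12), the density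
FRAME `GPDensity.mem_closure_nodeFamilyPrime`; the two ARC-AVOIDANCE providers enter as the hypotheses `harc0` / `harc1`
in the provider interface spelled out below (val-lit-p7 g13's `…GPArcSheets` certificates + `GPDensity.finite_setOf_exists_common_root_map`).

* **`gpNodeDensePrime_of_arc (harc0) (harc1)`** : the `hGP′` text of `recursion_of_gpNodeDensePrime` (density of the
  hereditary uniform-shift family among symmetric pencils, every `m`, every `K ≥ 2`, every normal-form support);
* (the by-name closer `recursion_holds : «PeelInequality» → «OsculationLaw» → «PosKPlusLogSqLaw»` of RULING #287 (b)
  follows in the sequel file once `harc0`/`harc1` are theorems: `recursion_of_gpNodeDensePrime (gpNodeDensePrime_of_arc …)`).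

Provider interface (`harc0`; `harc1` the same with `∀ Y, det Y ≠ 0 → split →` in front of the condition): for the diagonal
witness letters `W l = −diagonal (σ l)` (σ positive, distinct within each letter), every level `j` (`2 ≤ j`, `h : j+1 ≤ K+1`):
a FINITE exceptional set `F` of shifts, and for every shift `C ∉ F`, `C > 0`, `C >` every `σ l i`, and every symmetric
target `T`: a FINITE set of bad `ε` outside which the node-1 (resp. node-2) osculation set of the segment
`(1 − ε)•T + ε•W` at level `j` misses the arc `b = C·tᴺ` (resp. `b = tᴺ`), in the frame's spelling.
[folklore] bookkeeping.  Honest framing: the osculation LAW, `MatrixDescartes` (18050), Conjecture B and VP ≠ VNP are NOT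
proved here; no summit statement is proved by this file.
-/

set_option linter.dupNamespace false

namespace Summit.ValiantsHypothesis.ValiantsHypothesis.Theorems.LacunarySymmetroidMatrixDescartes.GPDensity

open Polynomial Matrix Filter Topology
open scoped BigOperators
open Summit.ValiantsHypothesis.ValiantsHypothesis.Theorems.MatrixDescartes.Negative (PosRootLawAt)

/-! ## Small utilities -/

/-- A letter-first positive diagonal datum on `Fin m` extends to `Fin m ⊕ Fin 0`, keeping positivity. -/
theorem sumElim_pos {K m : ℕ} {σ : Fin K → Fin m → ℝ} (hσ : ∀ l i, 0 < σ l i) (l : Fin K) (x : Fin m ⊕ Fin 0) :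
    0 < Sum.elim (σ l) Fin.elim0 x := by
  rcases x with i | i
  · exact hσ l i
  · exact i.elim0

/-- … and distinctness within each letter. -/
theorem sumElim_ne {K m : ℕ} {σ : Fin K → Fin m → ℝ} (hσ : ∀ l i i', i ≠ i' → σ l i ≠ σ l i') (l : Fin K)
    (x y : Fin m ⊕ Fin 0) (hxy : x ≠ y) : Sum.elim (σ l) Fin.elim0 x ≠ Sum.elim (σ l) Fin.elim0 y := by
  rcases x with i | i
  · rcases y with i' | i'
    · exact hσ l i i' (fun hii' => hxy (by rw [hii']))
    · exact i'.elim0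
  · exact i.elim0

/-- The diagonal witness letters are symmetric. -/
theorem isSymm_neg_diagonal {m : ℕ} (v : Fin m ⊕ Fin 0 → ℝ) :
    (-Matrix.diagonal v : Matrix (Fin m ⊕ Fin 0) (Fin m ⊕ Fin 0) ℝ).IsSymm := by
  unfold Matrix.IsSymm
  rw [Matrix.transpose_neg, Matrix.diagonal_transpose]

/-- A real number above a bound and outside a finite set. -/
theorem exists_gt_not_mem {F : Set ℝ} (hF : F.Finite) (b : ℝ) : ∃ C : ℝ, b < C ∧ C ∉ F := by
  obtain ⟨M, hM⟩ := (hF.insert b).bddAbove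
  refine ⟨M + 1, ?_, fun hmem => ?_⟩
  · have : b ≤ M := hM (Set.mem_insert _ _)
    linarith
  · have : M + 1 ≤ M := hM (Set.mem_insert_of_mem _ hmem)
    linarith

/-- Congruent pencils: a nonzero determinant of `Wᵀ S W`-letters forces a nonzero determinant of the `S`-letters. -/
theorem det_ne_zero_of_det_congr_ne_zero {ι : Type*} [Fintype ι] [DecidableEq ι] {K : ℕ} (W : Matrix ι ι ℝ)
    (d : Fin K → ℕ) (S : Fin K → Matrix ι ι ℝ)
    (h : (∑ l, (X : ℝ[X]) ^ d l • (Wᵀ * S l * W).map Polynomial.C).det ≠ 0) :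
    (∑ l, (X : ℝ[X]) ^ d l • (S l).map Polynomial.C).det ≠ 0 := by
  rw [OsculationRecursion.det_pencil_congr] at h
  exact right_ne_zero_of_mul h

/-! ## The density, modulo the two arc-avoidance providers -/

/-- **Density of the hereditary uniform-shift node family (ROUTE′ R6(a)), modulo arc avoidance.**  See the module
docstring for the provider interface `harc0` / `harc1`. [folklore] -/
theorem gpNodeDensePrime_of_arc
    (harc0 : ∀ (m K j : ℕ), 2 ≤ j → ∀ (d : Fin (K + 1) → ℕ), StrictMono d → d 0 = 0 →
      ∀ (σ : Fin (K + 1) → (Fin m ⊕ Fin 0) → ℝ), (∀ l i, 0 < σ l i) → (∀ l i i', i ≠ i' → σ l i ≠ σ l i') →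
      ∀ (W : Fin (K + 1) → Matrix (Fin m ⊕ Fin 0) (Fin m ⊕ Fin 0) ℝ), (∀ l, W l = -Matrix.diagonal (σ l)) →
      ∀ (h : j + 1 ≤ K + 1), ∃ F : Set ℝ, F.Finite ∧ ∀ (C : ℝ), C ∉ F → 0 < C → (∀ l i, σ l i < C) →
        ∀ (T : Fin (K + 1) → Matrix (Fin m ⊕ Fin 0) (Fin m ⊕ Fin 0) ℝ), (∀ l, (T l).IsSymm) →
          ∃ B : Set ℝ, B.Finite ∧ ∀ ε : ℝ, ε ∉ B →
            (∀ p ∈ {p : Fin 2 → ℝ | 0 < p 0 ∧ 0 < p 1 ∧ MvPolynomial.eval p (∑ l, (MvPolynomial.X (0 : Fin 2) : MvPolynomial (Fin 2) ℝ) ^ (fun l => d (Fin.castLE h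
          (Fin.castSucc l))) l • ((fun l => -(((1 - ε) • T + ε • W) (Fin.castLE h (Fin.castSucc l)))) l).map (MvPolynomial.C : ℝ →+* MvPolynomial (Fin 2) ℝ) +
          (MvPolynomial.X (1 : Fin 2) : MvPolynomial (Fin 2) ℝ) • (Matrix.fromBlocks 1 0 0 0 : Matrix (Fin m ⊕ Fin 0) (Fin m ⊕ Fin 0) ℝ).map (MvPolynomial.C : ℝ
          →+* MvPolynomial (Fin 2) ℝ)).det = 0 ∧ MvPolynomial.eval p (MvPolynomial.X 0 * MvPolynomial.pderiv 0 (MvPolynomial.X 0 * MvPolynomial.pderiv 0 (∑ l,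
          (MvPolynomial.X (0 : Fin 2) : MvPolynomial (Fin 2) ℝ) ^ (fun l => d (Fin.castLE h (Fin.castSucc l))) l • ((fun l => -(((1 - ε) • T + ε • W)
          (Fin.castLE h (Fin.castSucc l)))) l).map (MvPolynomial.C : ℝ →+* MvPolynomial (Fin 2) ℝ) + (MvPolynomial.X (1 : Fin 2) : MvPolynomial (Fin 2) ℝ) •
          (Matrix.fromBlocks 1 0 0 0 : Matrix (Fin m ⊕ Fin 0) (Fin m ⊕ Fin 0) ℝ).map (MvPolynomial.C : ℝ →+* MvPolynomial (Fin 2) ℝ)).det) * (MvPolynomial.X 1 *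
          MvPolynomial.pderiv 1 (∑ l, (MvPolynomial.X (0 : Fin 2) : MvPolynomial (Fin 2) ℝ) ^ (fun l => d (Fin.castLE h (Fin.castSucc l))) l • ((fun l => -(((1
          - ε) • T + ε • W) (Fin.castLE h (Fin.castSucc l)))) l).map (MvPolynomial.C : ℝ →+* MvPolynomial (Fin 2) ℝ) + (MvPolynomial.X (1 : Fin 2) :
          MvPolynomial (Fin 2) ℝ) • (Matrix.fromBlocks 1 0 0 0 : Matrix (Fin m ⊕ Fin 0) (Fin m ⊕ Fin 0) ℝ).map (MvPolynomial.C : ℝ →+* MvPolynomial (Fin 2)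
          ℝ)).det) ^ 2 - 2 * (MvPolynomial.X 0 * MvPolynomial.pderiv 0 (MvPolynomial.X 1 * MvPolynomial.pderiv 1 (∑ l, (MvPolynomial.X (0 : Fin 2) :
          MvPolynomial (Fin 2) ℝ) ^ (fun l => d (Fin.castLE h (Fin.castSucc l))) l • ((fun l => -(((1 - ε) • T + ε • W) (Fin.castLE h (Fin.castSucc l)))) l).map
          (MvPolynomial.C : ℝ →+* MvPolynomial (Fin 2) ℝ) + (MvPolynomial.X (1 : Fin 2) : MvPolynomial (Fin 2) ℝ) • (Matrix.fromBlocks 1 0 0 0 : Matrix (Fin m ⊕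
          Fin 0) (Fin m ⊕ Fin 0) ℝ).map (MvPolynomial.C : ℝ →+* MvPolynomial (Fin 2) ℝ)).det)) * (MvPolynomial.X 0 * MvPolynomial.pderiv 0 (∑ l, (MvPolynomial.X
          (0 : Fin 2) : MvPolynomial (Fin 2) ℝ) ^ (fun l => d (Fin.castLE h (Fin.castSucc l))) l • ((fun l => -(((1 - ε) • T + ε • W) (Fin.castLE h
          (Fin.castSucc l)))) l).map (MvPolynomial.C : ℝ →+* MvPolynomial (Fin 2) ℝ) + (MvPolynomial.X (1 : Fin 2) : MvPolynomial (Fin 2) ℝ) •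
          (Matrix.fromBlocks 1 0 0 0 : Matrix (Fin m ⊕ Fin 0) (Fin m ⊕ Fin 0) ℝ).map (MvPolynomial.C : ℝ →+* MvPolynomial (Fin 2) ℝ)).det) * (MvPolynomial.X 1 *
          MvPolynomial.pderiv 1 (∑ l, (MvPolynomial.X (0 : Fin 2) : MvPolynomial (Fin 2) ℝ) ^ (fun l => d (Fin.castLE h (Fin.castSucc l))) l • ((fun l => -(((1
          - ε) • T + ε • W) (Fin.castLE h (Fin.castSucc l)))) l).map (MvPolynomial.C : ℝ →+* MvPolynomial (Fin 2) ℝ) + (MvPolynomial.X (1 : Fin 2) :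
          MvPolynomial (Fin 2) ℝ) • (Matrix.fromBlocks 1 0 0 0 : Matrix (Fin m ⊕ Fin 0) (Fin m ⊕ Fin 0) ℝ).map (MvPolynomial.C : ℝ →+* MvPolynomial (Fin 2)
          ℝ)).det) + MvPolynomial.X 1 * MvPolynomial.pderiv 1 (MvPolynomial.X 1 * MvPolynomial.pderiv 1 (∑ l, (MvPolynomial.X (0 : Fin 2) : MvPolynomial (Fin 2)
          ℝ) ^ (fun l => d (Fin.castLE h (Fin.castSucc l))) l • ((fun l => -(((1 - ε) • T + ε • W) (Fin.castLE h (Fin.castSucc l)))) l).map (MvPolynomial.C : ℝ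
          →+* MvPolynomial (Fin 2) ℝ) + (MvPolynomial.X (1 : Fin 2) : MvPolynomial (Fin 2) ℝ) • (Matrix.fromBlocks 1 0 0 0 : Matrix (Fin m ⊕ Fin 0) (Fin m ⊕ Fin
          0) ℝ).map (MvPolynomial.C : ℝ →+* MvPolynomial (Fin 2) ℝ)).det) * (MvPolynomial.X 0 * MvPolynomial.pderiv 0 (∑ l, (MvPolynomial.X (0 : Fin 2) :
          MvPolynomial (Fin 2) ℝ) ^ (fun l => d (Fin.castLE h (Fin.castSucc l))) l • ((fun l => -(((1 - ε) • T + ε • W) (Fin.castLE h (Fin.castSucc l)))) l).map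
          (MvPolynomial.C : ℝ →+* MvPolynomial (Fin 2) ℝ) + (MvPolynomial.X (1 : Fin 2) : MvPolynomial (Fin 2) ℝ) • (Matrix.fromBlocks 1 0 0 0 : Matrix (Fin m ⊕
          Fin 0) (Fin m ⊕ Fin 0) ℝ).map (MvPolynomial.C : ℝ →+* MvPolynomial (Fin 2) ℝ)).det) ^ 2) = 0},
          p 1 ≠ C * p 0 ^ d (Fin.castLE h (Fin.last j))))
    (harc1 : ∀ (m K j : ℕ), 2 ≤ j → ∀ (d : Fin (K + 1) → ℕ), StrictMono d → d 0 = 0 →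
      ∀ (σ : Fin (K + 1) → (Fin m ⊕ Fin 0) → ℝ), (∀ l i, 0 < σ l i) → (∀ l i i', i ≠ i' → σ l i ≠ σ l i') →
      ∀ (W : Fin (K + 1) → Matrix (Fin m ⊕ Fin 0) (Fin m ⊕ Fin 0) ℝ), (∀ l, W l = -Matrix.diagonal (σ l)) →
      ∀ (h : j + 1 ≤ K + 1), ∃ F : Set ℝ, F.Finite ∧ ∀ (C : ℝ), C ∉ F → 0 < C → (∀ l i, σ l i < C) →
        ∀ (T : Fin (K + 1) → Matrix (Fin m ⊕ Fin 0) (Fin m ⊕ Fin 0) ℝ), (∀ l, (T l).IsSymm) →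
          ∃ B : Set ℝ, B.Finite ∧ ∀ ε : ℝ, ε ∉ B →
            ∀ Y : Matrix (Fin m ⊕ Fin 0) (Fin m ⊕ Fin 0) ℝ, Y.det ≠ 0 →
            ((1 - ε) • T + ε • W) (Fin.castLE h (Fin.last j)) = Yᵀ * Y - C • (1 : Matrix (Fin m ⊕ Fin 0) (Fin m ⊕ Fin 0) ℝ) →
            (∀ p ∈ {p : Fin 2 → ℝ | 0 < p 0 ∧ 0 < p 1 ∧ MvPolynomial.eval p (∑ l, (MvPolynomial.X (0 : Fin 2) : MvPolynomial (Fin 2) ℝ) ^ (fun l => d (Fin.castLE h l)) l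
          • ((fun l => (Y⁻¹)ᵀ * (Fin.snoc (fun l => ((1 - ε) • T + ε • W) (Fin.castLE h (Fin.castSucc l))) (-(C • (1 : Matrix (Fin m ⊕ Fin 0) (Fin m ⊕ Fin 0)
          ℝ))) : Fin (j + 1) → Matrix (Fin m ⊕ Fin 0) (Fin m ⊕ Fin 0) ℝ) l * Y⁻¹) l).map (MvPolynomial.C : ℝ →+* MvPolynomial (Fin 2) ℝ) + (MvPolynomial.X (1 :
          Fin 2) : MvPolynomial (Fin 2) ℝ) • (Matrix.fromBlocks 1 0 0 0 : Matrix (Fin m ⊕ Fin 0) (Fin m ⊕ Fin 0) ℝ).map (MvPolynomial.C : ℝ →+* MvPolynomial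
          (Fin 2) ℝ)).det = 0 ∧ MvPolynomial.eval p (MvPolynomial.X 0 * MvPolynomial.pderiv 0 (MvPolynomial.X 0 * MvPolynomial.pderiv 0 (∑ l, (MvPolynomial.X (0
          : Fin 2) : MvPolynomial (Fin 2) ℝ) ^ (fun l => d (Fin.castLE h l)) l • ((fun l => (Y⁻¹)ᵀ * (Fin.snoc (fun l => ((1 - ε) • T + ε • W) (Fin.castLE h
          (Fin.castSucc l))) (-(C • (1 : Matrix (Fin m ⊕ Fin 0) (Fin m ⊕ Fin 0) ℝ))) : Fin (j + 1) → Matrix (Fin m ⊕ Fin 0) (Fin m ⊕ Fin 0) ℝ) l * Y⁻¹) l).map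
          (MvPolynomial.C : ℝ →+* MvPolynomial (Fin 2) ℝ) + (MvPolynomial.X (1 : Fin 2) : MvPolynomial (Fin 2) ℝ) • (Matrix.fromBlocks 1 0 0 0 : Matrix (Fin m ⊕
          Fin 0) (Fin m ⊕ Fin 0) ℝ).map (MvPolynomial.C : ℝ →+* MvPolynomial (Fin 2) ℝ)).det) * (MvPolynomial.X 1 * MvPolynomial.pderiv 1 (∑ l, (MvPolynomial.X
          (0 : Fin 2) : MvPolynomial (Fin 2) ℝ) ^ (fun l => d (Fin.castLE h l)) l • ((fun l => (Y⁻¹)ᵀ * (Fin.snoc (fun l => ((1 - ε) • T + ε • W) (Fin.castLE h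
          (Fin.castSucc l))) (-(C • (1 : Matrix (Fin m ⊕ Fin 0) (Fin m ⊕ Fin 0) ℝ))) : Fin (j + 1) → Matrix (Fin m ⊕ Fin 0) (Fin m ⊕ Fin 0) ℝ) l * Y⁻¹) l).map
          (MvPolynomial.C : ℝ →+* MvPolynomial (Fin 2) ℝ) + (MvPolynomial.X (1 : Fin 2) : MvPolynomial (Fin 2) ℝ) • (Matrix.fromBlocks 1 0 0 0 : Matrix (Fin m ⊕
          Fin 0) (Fin m ⊕ Fin 0) ℝ).map (MvPolynomial.C : ℝ →+* MvPolynomial (Fin 2) ℝ)).det) ^ 2 - 2 * (MvPolynomial.X 0 * MvPolynomial.pderiv 0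
          (MvPolynomial.X 1 * MvPolynomial.pderiv 1 (∑ l, (MvPolynomial.X (0 : Fin 2) : MvPolynomial (Fin 2) ℝ) ^ (fun l => d (Fin.castLE h l)) l • ((fun l =>
          (Y⁻¹)ᵀ * (Fin.snoc (fun l => ((1 - ε) • T + ε • W) (Fin.castLE h (Fin.castSucc l))) (-(C • (1 : Matrix (Fin m ⊕ Fin 0) (Fin m ⊕ Fin 0) ℝ))) : Fin (j +
          1) → Matrix (Fin m ⊕ Fin 0) (Fin m ⊕ Fin 0) ℝ) l * Y⁻¹) l).map (MvPolynomial.C : ℝ →+* MvPolynomial (Fin 2) ℝ) + (MvPolynomial.X (1 : Fin 2) :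
          MvPolynomial (Fin 2) ℝ) • (Matrix.fromBlocks 1 0 0 0 : Matrix (Fin m ⊕ Fin 0) (Fin m ⊕ Fin 0) ℝ).map (MvPolynomial.C : ℝ →+* MvPolynomial (Fin 2)
          ℝ)).det)) * (MvPolynomial.X 0 * MvPolynomial.pderiv 0 (∑ l, (MvPolynomial.X (0 : Fin 2) : MvPolynomial (Fin 2) ℝ) ^ (fun l => d (Fin.castLE h l)) l •
          ((fun l => (Y⁻¹)ᵀ * (Fin.snoc (fun l => ((1 - ε) • T + ε • W) (Fin.castLE h (Fin.castSucc l))) (-(C • (1 : Matrix (Fin m ⊕ Fin 0) (Fin m ⊕ Fin 0) ℝ)))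
          : Fin (j + 1) → Matrix (Fin m ⊕ Fin 0) (Fin m ⊕ Fin 0) ℝ) l * Y⁻¹) l).map (MvPolynomial.C : ℝ →+* MvPolynomial (Fin 2) ℝ) + (MvPolynomial.X (1 : Fin
          2) : MvPolynomial (Fin 2) ℝ) • (Matrix.fromBlocks 1 0 0 0 : Matrix (Fin m ⊕ Fin 0) (Fin m ⊕ Fin 0) ℝ).map (MvPolynomial.C : ℝ →+* MvPolynomial (Fin 2)
          ℝ)).det) * (MvPolynomial.X 1 * MvPolynomial.pderiv 1 (∑ l, (MvPolynomial.X (0 : Fin 2) : MvPolynomial (Fin 2) ℝ) ^ (fun l => d (Fin.castLE h l)) l •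
          ((fun l => (Y⁻¹)ᵀ * (Fin.snoc (fun l => ((1 - ε) • T + ε • W) (Fin.castLE h (Fin.castSucc l))) (-(C • (1 : Matrix (Fin m ⊕ Fin 0) (Fin m ⊕ Fin 0) ℝ)))
          : Fin (j + 1) → Matrix (Fin m ⊕ Fin 0) (Fin m ⊕ Fin 0) ℝ) l * Y⁻¹) l).map (MvPolynomial.C : ℝ →+* MvPolynomial (Fin 2) ℝ) + (MvPolynomial.X (1 : Fin
          2) : MvPolynomial (Fin 2) ℝ) • (Matrix.fromBlocks 1 0 0 0 : Matrix (Fin m ⊕ Fin 0) (Fin m ⊕ Fin 0) ℝ).map (MvPolynomial.C : ℝ →+* MvPolynomial (Fin 2)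
          ℝ)).det) + MvPolynomial.X 1 * MvPolynomial.pderiv 1 (MvPolynomial.X 1 * MvPolynomial.pderiv 1 (∑ l, (MvPolynomial.X (0 : Fin 2) : MvPolynomial (Fin 2)
          ℝ) ^ (fun l => d (Fin.castLE h l)) l • ((fun l => (Y⁻¹)ᵀ * (Fin.snoc (fun l => ((1 - ε) • T + ε • W) (Fin.castLE h (Fin.castSucc l))) (-(C • (1 :
          Matrix (Fin m ⊕ Fin 0) (Fin m ⊕ Fin 0) ℝ))) : Fin (j + 1) → Matrix (Fin m ⊕ Fin 0) (Fin m ⊕ Fin 0) ℝ) l * Y⁻¹) l).map (MvPolynomial.C : ℝ →+*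
          MvPolynomial (Fin 2) ℝ) + (MvPolynomial.X (1 : Fin 2) : MvPolynomial (Fin 2) ℝ) • (Matrix.fromBlocks 1 0 0 0 : Matrix (Fin m ⊕ Fin 0) (Fin m ⊕ Fin 0)
          ℝ).map (MvPolynomial.C : ℝ →+* MvPolynomial (Fin 2) ℝ)).det) * (MvPolynomial.X 0 * MvPolynomial.pderiv 0 (∑ l, (MvPolynomial.X (0 : Fin 2) :
          MvPolynomial (Fin 2) ℝ) ^ (fun l => d (Fin.castLE h l)) l • ((fun l => (Y⁻¹)ᵀ * (Fin.snoc (fun l => ((1 - ε) • T + ε • W) (Fin.castLE h (Fin.castSucc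
          l))) (-(C • (1 : Matrix (Fin m ⊕ Fin 0) (Fin m ⊕ Fin 0) ℝ))) : Fin (j + 1) → Matrix (Fin m ⊕ Fin 0) (Fin m ⊕ Fin 0) ℝ) l * Y⁻¹) l).map (MvPolynomial.C
          : ℝ →+* MvPolynomial (Fin 2) ℝ) + (MvPolynomial.X (1 : Fin 2) : MvPolynomial (Fin 2) ℝ) • (Matrix.fromBlocks 1 0 0 0 : Matrix (Fin m ⊕ Fin 0) (Fin m ⊕
          Fin 0) ℝ).map (MvPolynomial.C : ℝ →+* MvPolynomial (Fin 2) ℝ)).det) ^ 2) = 0},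
          p 1 ≠ 1 * p 0 ^ d (Fin.castLE h (Fin.last j)))) :
    ∀ (m K : ℕ), 2 ≤ K → ∀ (d : Fin (K + 1) → ℕ), StrictMono d → d 0 = 0 →
      ∀ T : Fin (K + 1) → Matrix (Fin m ⊕ Fin 0) (Fin m ⊕ Fin 0) ℝ, (∀ l, (T l).IsSymm) →
        T ∈ closure {S : Fin (K + 1) → Matrix (Fin m ⊕ Fin 0) (Fin m ⊕ Fin 0) ℝ |
      (∀ l, (S l).IsSymm) ∧ ∃ C : ℝ, ∀ (j : ℕ), 2 ≤ j → ∀ (h : j + 1 ≤ K + 1),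
        ∃ (Y : Matrix (Fin m ⊕ Fin 0) (Fin m ⊕ Fin 0) ℝ) (d₀ : Fin j → ℕ) (S₀ : Fin j → Matrix (Fin m ⊕ Fin 0) (Fin m ⊕ Fin 0) ℝ) (S₁ : Fin (j + 1) → Matrix (Fin m ⊕ Fin 0) (Fin m ⊕ Fin 0) ℝ),
          Y.det ≠ 0 ∧ 0 < C ∧ S (Fin.castLE h (Fin.last j)) = Yᵀ * Y - C • (1 : Matrix (Fin m ⊕ Fin 0) (Fin m ⊕ Fin 0) ℝ) ∧
          (∀ l, d₀ l = d (Fin.castLE h (Fin.castSucc l))) ∧ (∀ l, S₀ l = -S (Fin.castLE h (Fin.castSucc l))) ∧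
          (∀ l, S₁ l = (Y⁻¹)ᵀ * (Fin.snoc (fun l => S (Fin.castLE h (Fin.castSucc l))) (-(C • (1 : Matrix (Fin m ⊕ Fin 0) (Fin m ⊕ Fin 0) ℝ))) :
            Fin (j + 1) → Matrix (Fin m ⊕ Fin 0) (Fin m ⊕ Fin 0) ℝ) l * Y⁻¹) ∧
          (∑ l, (X : ℝ[X]) ^ d₀ l • (S₀ l).map Polynomial.C).det ≠ 0 ∧
        {p : Fin 2 → ℝ | 0 < p 0 ∧ 0 < p 1 ∧ MvPolynomial.eval p (∑ l, (MvPolynomial.X (0 : Fin 2) : MvPolynomial (Fin 2) ℝ) ^ d₀ l • (S₀ l).map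
          (MvPolynomial.C : ℝ →+* MvPolynomial (Fin 2) ℝ) + (MvPolynomial.X (1 : Fin 2) : MvPolynomial (Fin 2) ℝ) • (Matrix.fromBlocks 1 0 0 0 : Matrix (Fin m ⊕
          Fin 0) (Fin m ⊕ Fin 0) ℝ).map (MvPolynomial.C : ℝ →+* MvPolynomial (Fin 2) ℝ)).det = 0 ∧ MvPolynomial.eval p (MvPolynomial.X 0 * MvPolynomial.pderiv 0
          (MvPolynomial.X 0 * MvPolynomial.pderiv 0 (∑ l, (MvPolynomial.X (0 : Fin 2) : MvPolynomial (Fin 2) ℝ) ^ d₀ l • (S₀ l).map (MvPolynomial.C : ℝ →+*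
          MvPolynomial (Fin 2) ℝ) + (MvPolynomial.X (1 : Fin 2) : MvPolynomial (Fin 2) ℝ) • (Matrix.fromBlocks 1 0 0 0 : Matrix (Fin m ⊕ Fin 0) (Fin m ⊕ Fin 0)
          ℝ).map (MvPolynomial.C : ℝ →+* MvPolynomial (Fin 2) ℝ)).det) * (MvPolynomial.X 1 * MvPolynomial.pderiv 1 (∑ l, (MvPolynomial.X (0 : Fin 2) :
          MvPolynomial (Fin 2) ℝ) ^ d₀ l • (S₀ l).map (MvPolynomial.C : ℝ →+* MvPolynomial (Fin 2) ℝ) + (MvPolynomial.X (1 : Fin 2) : MvPolynomial (Fin 2) ℝ) •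
          (Matrix.fromBlocks 1 0 0 0 : Matrix (Fin m ⊕ Fin 0) (Fin m ⊕ Fin 0) ℝ).map (MvPolynomial.C : ℝ →+* MvPolynomial (Fin 2) ℝ)).det) ^ 2 - 2 *
          (MvPolynomial.X 0 * MvPolynomial.pderiv 0 (MvPolynomial.X 1 * MvPolynomial.pderiv 1 (∑ l, (MvPolynomial.X (0 : Fin 2) : MvPolynomial (Fin 2) ℝ) ^ d₀ l
          • (S₀ l).map (MvPolynomial.C : ℝ →+* MvPolynomial (Fin 2) ℝ) + (MvPolynomial.X (1 : Fin 2) : MvPolynomial (Fin 2) ℝ) • (Matrix.fromBlocks 1 0 0 0 :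
          Matrix (Fin m ⊕ Fin 0) (Fin m ⊕ Fin 0) ℝ).map (MvPolynomial.C : ℝ →+* MvPolynomial (Fin 2) ℝ)).det)) * (MvPolynomial.X 0 * MvPolynomial.pderiv 0 (∑ l,
          (MvPolynomial.X (0 : Fin 2) : MvPolynomial (Fin 2) ℝ) ^ d₀ l • (S₀ l).map (MvPolynomial.C : ℝ →+* MvPolynomial (Fin 2) ℝ) + (MvPolynomial.X (1 : Fin
          2) : MvPolynomial (Fin 2) ℝ) • (Matrix.fromBlocks 1 0 0 0 : Matrix (Fin m ⊕ Fin 0) (Fin m ⊕ Fin 0) ℝ).map (MvPolynomial.C : ℝ →+* MvPolynomial (Fin 2)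
          ℝ)).det) * (MvPolynomial.X 1 * MvPolynomial.pderiv 1 (∑ l, (MvPolynomial.X (0 : Fin 2) : MvPolynomial (Fin 2) ℝ) ^ d₀ l • (S₀ l).map (MvPolynomial.C :
          ℝ →+* MvPolynomial (Fin 2) ℝ) + (MvPolynomial.X (1 : Fin 2) : MvPolynomial (Fin 2) ℝ) • (Matrix.fromBlocks 1 0 0 0 : Matrix (Fin m ⊕ Fin 0) (Fin m ⊕
          Fin 0) ℝ).map (MvPolynomial.C : ℝ →+* MvPolynomial (Fin 2) ℝ)).det) + MvPolynomial.X 1 * MvPolynomial.pderiv 1 (MvPolynomial.X 1 * MvPolynomial.pderiv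
          1 (∑ l, (MvPolynomial.X (0 : Fin 2) : MvPolynomial (Fin 2) ℝ) ^ d₀ l • (S₀ l).map (MvPolynomial.C : ℝ →+* MvPolynomial (Fin 2) ℝ) + (MvPolynomial.X (1
          : Fin 2) : MvPolynomial (Fin 2) ℝ) • (Matrix.fromBlocks 1 0 0 0 : Matrix (Fin m ⊕ Fin 0) (Fin m ⊕ Fin 0) ℝ).map (MvPolynomial.C : ℝ →+* MvPolynomial
          (Fin 2) ℝ)).det) * (MvPolynomial.X 0 * MvPolynomial.pderiv 0 (∑ l, (MvPolynomial.X (0 : Fin 2) : MvPolynomial (Fin 2) ℝ) ^ d₀ l • (S₀ l).map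
          (MvPolynomial.C : ℝ →+* MvPolynomial (Fin 2) ℝ) + (MvPolynomial.X (1 : Fin 2) : MvPolynomial (Fin 2) ℝ) • (Matrix.fromBlocks 1 0 0 0 : Matrix (Fin m ⊕
          Fin 0) (Fin m ⊕ Fin 0) ℝ).map (MvPolynomial.C : ℝ →+* MvPolynomial (Fin 2) ℝ)).det) ^ 2) = 0}.Finite ∧
        (∀ p ∈ {p : Fin 2 → ℝ | 0 < p 0 ∧ 0 < p 1 ∧ MvPolynomial.eval p (∑ l, (MvPolynomial.X (0 : Fin 2) : MvPolynomial (Fin 2) ℝ) ^ d₀ l • (S₀ l).map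
          (MvPolynomial.C : ℝ →+* MvPolynomial (Fin 2) ℝ) + (MvPolynomial.X (1 : Fin 2) : MvPolynomial (Fin 2) ℝ) • (Matrix.fromBlocks 1 0 0 0 : Matrix (Fin m ⊕
          Fin 0) (Fin m ⊕ Fin 0) ℝ).map (MvPolynomial.C : ℝ →+* MvPolynomial (Fin 2) ℝ)).det = 0 ∧ MvPolynomial.eval p (MvPolynomial.X 0 * MvPolynomial.pderiv 0
          (MvPolynomial.X 0 * MvPolynomial.pderiv 0 (∑ l, (MvPolynomial.X (0 : Fin 2) : MvPolynomial (Fin 2) ℝ) ^ d₀ l • (S₀ l).map (MvPolynomial.C : ℝ →+*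
          MvPolynomial (Fin 2) ℝ) + (MvPolynomial.X (1 : Fin 2) : MvPolynomial (Fin 2) ℝ) • (Matrix.fromBlocks 1 0 0 0 : Matrix (Fin m ⊕ Fin 0) (Fin m ⊕ Fin 0)
          ℝ).map (MvPolynomial.C : ℝ →+* MvPolynomial (Fin 2) ℝ)).det) * (MvPolynomial.X 1 * MvPolynomial.pderiv 1 (∑ l, (MvPolynomial.X (0 : Fin 2) :
          MvPolynomial (Fin 2) ℝ) ^ d₀ l • (S₀ l).map (MvPolynomial.C : ℝ →+* MvPolynomial (Fin 2) ℝ) + (MvPolynomial.X (1 : Fin 2) : MvPolynomial (Fin 2) ℝ) •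
          (Matrix.fromBlocks 1 0 0 0 : Matrix (Fin m ⊕ Fin 0) (Fin m ⊕ Fin 0) ℝ).map (MvPolynomial.C : ℝ →+* MvPolynomial (Fin 2) ℝ)).det) ^ 2 - 2 *
          (MvPolynomial.X 0 * MvPolynomial.pderiv 0 (MvPolynomial.X 1 * MvPolynomial.pderiv 1 (∑ l, (MvPolynomial.X (0 : Fin 2) : MvPolynomial (Fin 2) ℝ) ^ d₀ l
          • (S₀ l).map (MvPolynomial.C : ℝ →+* MvPolynomial (Fin 2) ℝ) + (MvPolynomial.X (1 : Fin 2) : MvPolynomial (Fin 2) ℝ) • (Matrix.fromBlocks 1 0 0 0 :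
          Matrix (Fin m ⊕ Fin 0) (Fin m ⊕ Fin 0) ℝ).map (MvPolynomial.C : ℝ →+* MvPolynomial (Fin 2) ℝ)).det)) * (MvPolynomial.X 0 * MvPolynomial.pderiv 0 (∑ l,
          (MvPolynomial.X (0 : Fin 2) : MvPolynomial (Fin 2) ℝ) ^ d₀ l • (S₀ l).map (MvPolynomial.C : ℝ →+* MvPolynomial (Fin 2) ℝ) + (MvPolynomial.X (1 : Fin
          2) : MvPolynomial (Fin 2) ℝ) • (Matrix.fromBlocks 1 0 0 0 : Matrix (Fin m ⊕ Fin 0) (Fin m ⊕ Fin 0) ℝ).map (MvPolynomial.C : ℝ →+* MvPolynomial (Fin 2)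
          ℝ)).det) * (MvPolynomial.X 1 * MvPolynomial.pderiv 1 (∑ l, (MvPolynomial.X (0 : Fin 2) : MvPolynomial (Fin 2) ℝ) ^ d₀ l • (S₀ l).map (MvPolynomial.C :
          ℝ →+* MvPolynomial (Fin 2) ℝ) + (MvPolynomial.X (1 : Fin 2) : MvPolynomial (Fin 2) ℝ) • (Matrix.fromBlocks 1 0 0 0 : Matrix (Fin m ⊕ Fin 0) (Fin m ⊕
          Fin 0) ℝ).map (MvPolynomial.C : ℝ →+* MvPolynomial (Fin 2) ℝ)).det) + MvPolynomial.X 1 * MvPolynomial.pderiv 1 (MvPolynomial.X 1 * MvPolynomial.pderiv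
          1 (∑ l, (MvPolynomial.X (0 : Fin 2) : MvPolynomial (Fin 2) ℝ) ^ d₀ l • (S₀ l).map (MvPolynomial.C : ℝ →+* MvPolynomial (Fin 2) ℝ) + (MvPolynomial.X (1
          : Fin 2) : MvPolynomial (Fin 2) ℝ) • (Matrix.fromBlocks 1 0 0 0 : Matrix (Fin m ⊕ Fin 0) (Fin m ⊕ Fin 0) ℝ).map (MvPolynomial.C : ℝ →+* MvPolynomial
          (Fin 2) ℝ)).det) * (MvPolynomial.X 0 * MvPolynomial.pderiv 0 (∑ l, (MvPolynomial.X (0 : Fin 2) : MvPolynomial (Fin 2) ℝ) ^ d₀ l • (S₀ l).map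
          (MvPolynomial.C : ℝ →+* MvPolynomial (Fin 2) ℝ) + (MvPolynomial.X (1 : Fin 2) : MvPolynomial (Fin 2) ℝ) • (Matrix.fromBlocks 1 0 0 0 : Matrix (Fin m ⊕
          Fin 0) (Fin m ⊕ Fin 0) ℝ).map (MvPolynomial.C : ℝ →+* MvPolynomial (Fin 2) ℝ)).det) ^ 2) = 0},
          p 1 ≠ C * p 0 ^ d (Fin.castLE h (Fin.last j))) ∧
        (∑ l, (X : ℝ[X]) ^ (fun l => d (Fin.castLE h l)) l • (S₁ l).map Polynomial.C).det ≠ 0 ∧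
        {p : Fin 2 → ℝ | 0 < p 0 ∧ 0 < p 1 ∧ MvPolynomial.eval p (∑ l, (MvPolynomial.X (0 : Fin 2) : MvPolynomial (Fin 2) ℝ) ^ (fun l => d (Fin.castLE h l)) l
          • (S₁ l).map (MvPolynomial.C : ℝ →+* MvPolynomial (Fin 2) ℝ) + (MvPolynomial.X (1 : Fin 2) : MvPolynomial (Fin 2) ℝ) • (Matrix.fromBlocks 1 0 0 0 :
          Matrix (Fin m ⊕ Fin 0) (Fin m ⊕ Fin 0) ℝ).map (MvPolynomial.C : ℝ →+* MvPolynomial (Fin 2) ℝ)).det = 0 ∧ MvPolynomial.eval p (MvPolynomial.X 0 *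
          MvPolynomial.pderiv 0 (MvPolynomial.X 0 * MvPolynomial.pderiv 0 (∑ l, (MvPolynomial.X (0 : Fin 2) : MvPolynomial (Fin 2) ℝ) ^ (fun l => d (Fin.castLE
          h l)) l • (S₁ l).map (MvPolynomial.C : ℝ →+* MvPolynomial (Fin 2) ℝ) + (MvPolynomial.X (1 : Fin 2) : MvPolynomial (Fin 2) ℝ) • (Matrix.fromBlocks 1 0
          0 0 : Matrix (Fin m ⊕ Fin 0) (Fin m ⊕ Fin 0) ℝ).map (MvPolynomial.C : ℝ →+* MvPolynomial (Fin 2) ℝ)).det) * (MvPolynomial.X 1 * MvPolynomial.pderiv 1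
          (∑ l, (MvPolynomial.X (0 : Fin 2) : MvPolynomial (Fin 2) ℝ) ^ (fun l => d (Fin.castLE h l)) l • (S₁ l).map (MvPolynomial.C : ℝ →+* MvPolynomial (Fin
          2) ℝ) + (MvPolynomial.X (1 : Fin 2) : MvPolynomial (Fin 2) ℝ) • (Matrix.fromBlocks 1 0 0 0 : Matrix (Fin m ⊕ Fin 0) (Fin m ⊕ Fin 0) ℝ).map
          (MvPolynomial.C : ℝ →+* MvPolynomial (Fin 2) ℝ)).det) ^ 2 - 2 * (MvPolynomial.X 0 * MvPolynomial.pderiv 0 (MvPolynomial.X 1 * MvPolynomial.pderiv 1 (∑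
          l, (MvPolynomial.X (0 : Fin 2) : MvPolynomial (Fin 2) ℝ) ^ (fun l => d (Fin.castLE h l)) l • (S₁ l).map (MvPolynomial.C : ℝ →+* MvPolynomial (Fin 2)
          ℝ) + (MvPolynomial.X (1 : Fin 2) : MvPolynomial (Fin 2) ℝ) • (Matrix.fromBlocks 1 0 0 0 : Matrix (Fin m ⊕ Fin 0) (Fin m ⊕ Fin 0) ℝ).map
          (MvPolynomial.C : ℝ →+* MvPolynomial (Fin 2) ℝ)).det)) * (MvPolynomial.X 0 * MvPolynomial.pderiv 0 (∑ l, (MvPolynomial.X (0 : Fin 2) : MvPolynomial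
          (Fin 2) ℝ) ^ (fun l => d (Fin.castLE h l)) l • (S₁ l).map (MvPolynomial.C : ℝ →+* MvPolynomial (Fin 2) ℝ) + (MvPolynomial.X (1 : Fin 2) : MvPolynomial
          (Fin 2) ℝ) • (Matrix.fromBlocks 1 0 0 0 : Matrix (Fin m ⊕ Fin 0) (Fin m ⊕ Fin 0) ℝ).map (MvPolynomial.C : ℝ →+* MvPolynomial (Fin 2) ℝ)).det) *
          (MvPolynomial.X 1 * MvPolynomial.pderiv 1 (∑ l, (MvPolynomial.X (0 : Fin 2) : MvPolynomial (Fin 2) ℝ) ^ (fun l => d (Fin.castLE h l)) l • (S₁ l).map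
          (MvPolynomial.C : ℝ →+* MvPolynomial (Fin 2) ℝ) + (MvPolynomial.X (1 : Fin 2) : MvPolynomial (Fin 2) ℝ) • (Matrix.fromBlocks 1 0 0 0 : Matrix (Fin m ⊕
          Fin 0) (Fin m ⊕ Fin 0) ℝ).map (MvPolynomial.C : ℝ →+* MvPolynomial (Fin 2) ℝ)).det) + MvPolynomial.X 1 * MvPolynomial.pderiv 1 (MvPolynomial.X 1 *
          MvPolynomial.pderiv 1 (∑ l, (MvPolynomial.X (0 : Fin 2) : MvPolynomial (Fin 2) ℝ) ^ (fun l => d (Fin.castLE h l)) l • (S₁ l).map (MvPolynomial.C : ℝ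
          →+* MvPolynomial (Fin 2) ℝ) + (MvPolynomial.X (1 : Fin 2) : MvPolynomial (Fin 2) ℝ) • (Matrix.fromBlocks 1 0 0 0 : Matrix (Fin m ⊕ Fin 0) (Fin m ⊕ Fin
          0) ℝ).map (MvPolynomial.C : ℝ →+* MvPolynomial (Fin 2) ℝ)).det) * (MvPolynomial.X 0 * MvPolynomial.pderiv 0 (∑ l, (MvPolynomial.X (0 : Fin 2) :
          MvPolynomial (Fin 2) ℝ) ^ (fun l => d (Fin.castLE h l)) l • (S₁ l).map (MvPolynomial.C : ℝ →+* MvPolynomial (Fin 2) ℝ) + (MvPolynomial.X (1 : Fin 2) :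
          MvPolynomial (Fin 2) ℝ) • (Matrix.fromBlocks 1 0 0 0 : Matrix (Fin m ⊕ Fin 0) (Fin m ⊕ Fin 0) ℝ).map (MvPolynomial.C : ℝ →+* MvPolynomial (Fin 2)
          ℝ)).det) ^ 2) = 0}.Finite ∧
        (∀ p ∈ {p : Fin 2 → ℝ | 0 < p 0 ∧ 0 < p 1 ∧ MvPolynomial.eval p (∑ l, (MvPolynomial.X (0 : Fin 2) : MvPolynomial (Fin 2) ℝ) ^ (fun l => d (Fin.castLE h l)) l
          • (S₁ l).map (MvPolynomial.C : ℝ →+* MvPolynomial (Fin 2) ℝ) + (MvPolynomial.X (1 : Fin 2) : MvPolynomial (Fin 2) ℝ) • (Matrix.fromBlocks 1 0 0 0 :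
          Matrix (Fin m ⊕ Fin 0) (Fin m ⊕ Fin 0) ℝ).map (MvPolynomial.C : ℝ →+* MvPolynomial (Fin 2) ℝ)).det = 0 ∧ MvPolynomial.eval p (MvPolynomial.X 0 *
          MvPolynomial.pderiv 0 (MvPolynomial.X 0 * MvPolynomial.pderiv 0 (∑ l, (MvPolynomial.X (0 : Fin 2) : MvPolynomial (Fin 2) ℝ) ^ (fun l => d (Fin.castLE
          h l)) l • (S₁ l).map (MvPolynomial.C : ℝ →+* MvPolynomial (Fin 2) ℝ) + (MvPolynomial.X (1 : Fin 2) : MvPolynomial (Fin 2) ℝ) • (Matrix.fromBlocks 1 0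
          0 0 : Matrix (Fin m ⊕ Fin 0) (Fin m ⊕ Fin 0) ℝ).map (MvPolynomial.C : ℝ →+* MvPolynomial (Fin 2) ℝ)).det) * (MvPolynomial.X 1 * MvPolynomial.pderiv 1
          (∑ l, (MvPolynomial.X (0 : Fin 2) : MvPolynomial (Fin 2) ℝ) ^ (fun l => d (Fin.castLE h l)) l • (S₁ l).map (MvPolynomial.C : ℝ →+* MvPolynomial (Fin
          2) ℝ) + (MvPolynomial.X (1 : Fin 2) : MvPolynomial (Fin 2) ℝ) • (Matrix.fromBlocks 1 0 0 0 : Matrix (Fin m ⊕ Fin 0) (Fin m ⊕ Fin 0) ℝ).map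
          (MvPolynomial.C : ℝ →+* MvPolynomial (Fin 2) ℝ)).det) ^ 2 - 2 * (MvPolynomial.X 0 * MvPolynomial.pderiv 0 (MvPolynomial.X 1 * MvPolynomial.pderiv 1 (∑
          l, (MvPolynomial.X (0 : Fin 2) : MvPolynomial (Fin 2) ℝ) ^ (fun l => d (Fin.castLE h l)) l • (S₁ l).map (MvPolynomial.C : ℝ →+* MvPolynomial (Fin 2)
          ℝ) + (MvPolynomial.X (1 : Fin 2) : MvPolynomial (Fin 2) ℝ) • (Matrix.fromBlocks 1 0 0 0 : Matrix (Fin m ⊕ Fin 0) (Fin m ⊕ Fin 0) ℝ).map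
          (MvPolynomial.C : ℝ →+* MvPolynomial (Fin 2) ℝ)).det)) * (MvPolynomial.X 0 * MvPolynomial.pderiv 0 (∑ l, (MvPolynomial.X (0 : Fin 2) : MvPolynomial
          (Fin 2) ℝ) ^ (fun l => d (Fin.castLE h l)) l • (S₁ l).map (MvPolynomial.C : ℝ →+* MvPolynomial (Fin 2) ℝ) + (MvPolynomial.X (1 : Fin 2) : MvPolynomial
          (Fin 2) ℝ) • (Matrix.fromBlocks 1 0 0 0 : Matrix (Fin m ⊕ Fin 0) (Fin m ⊕ Fin 0) ℝ).map (MvPolynomial.C : ℝ →+* MvPolynomial (Fin 2) ℝ)).det) *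
          (MvPolynomial.X 1 * MvPolynomial.pderiv 1 (∑ l, (MvPolynomial.X (0 : Fin 2) : MvPolynomial (Fin 2) ℝ) ^ (fun l => d (Fin.castLE h l)) l • (S₁ l).map
          (MvPolynomial.C : ℝ →+* MvPolynomial (Fin 2) ℝ) + (MvPolynomial.X (1 : Fin 2) : MvPolynomial (Fin 2) ℝ) • (Matrix.fromBlocks 1 0 0 0 : Matrix (Fin m ⊕
          Fin 0) (Fin m ⊕ Fin 0) ℝ).map (MvPolynomial.C : ℝ →+* MvPolynomial (Fin 2) ℝ)).det) + MvPolynomial.X 1 * MvPolynomial.pderiv 1 (MvPolynomial.X 1 *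
          MvPolynomial.pderiv 1 (∑ l, (MvPolynomial.X (0 : Fin 2) : MvPolynomial (Fin 2) ℝ) ^ (fun l => d (Fin.castLE h l)) l • (S₁ l).map (MvPolynomial.C : ℝ
          →+* MvPolynomial (Fin 2) ℝ) + (MvPolynomial.X (1 : Fin 2) : MvPolynomial (Fin 2) ℝ) • (Matrix.fromBlocks 1 0 0 0 : Matrix (Fin m ⊕ Fin 0) (Fin m ⊕ Fin
          0) ℝ).map (MvPolynomial.C : ℝ →+* MvPolynomial (Fin 2) ℝ)).det) * (MvPolynomial.X 0 * MvPolynomial.pderiv 0 (∑ l, (MvPolynomial.X (0 : Fin 2) :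
          MvPolynomial (Fin 2) ℝ) ^ (fun l => d (Fin.castLE h l)) l • (S₁ l).map (MvPolynomial.C : ℝ →+* MvPolynomial (Fin 2) ℝ) + (MvPolynomial.X (1 : Fin 2) :
          MvPolynomial (Fin 2) ℝ) • (Matrix.fromBlocks 1 0 0 0 : Matrix (Fin m ⊕ Fin 0) (Fin m ⊕ Fin 0) ℝ).map (MvPolynomial.C : ℝ →+* MvPolynomial (Fin 2)
          ℝ)).det) ^ 2) = 0},
          p 1 ≠ 1 * p 0 ^ d (Fin.castLE h (Fin.last j)))} := by
  intro m K hK d hd h0 T hT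
  classical
  -- the generic diagonal witness (no extra polynomial conditions are needed here)
  obtain ⟨σ₀, hσ₀pos, -, hσ₀inj, -⟩ :=
    OsculationGeneric.exists_generic_diagonal_witness' m (K + 1) d hd (fun _ => h0) ∅ (by simp)
  let σ : Fin (K + 1) → (Fin m ⊕ Fin 0) → ℝ := fun l => Sum.elim (σ₀ l) Fin.elim0
  have hσpos : ∀ l i, 0 < σ l i := fun l x => sumElim_pos hσ₀pos l x
  have hσinj : ∀ l i i', i ≠ i' → σ l i ≠ σ l i' := fun l x y hxy => sumElim_ne hσ₀inj l x y hxy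
  let W : Fin (K + 1) → Matrix (Fin m ⊕ Fin 0) (Fin m ⊕ Fin 0) ℝ := fun l => -Matrix.diagonal (σ l)
  have hWdef : ∀ l, W l = -Matrix.diagonal (σ l) := fun _ => rfl
  have hW : ∀ l, (W l).IsSymm := fun l => isSymm_neg_diagonal (σ l)
  -- the arc-avoidance exceptional shifts, per level
  have hA0 := fun (j : ℕ) (hj : 2 ≤ j) (h : j + 1 ≤ K + 1) =>
    harc0 m K j hj d hd h0 σ hσpos hσinj W hWdef h
  have hA1 := fun (j : ℕ) (hj : 2 ≤ j) (h : j + 1 ≤ K + 1) =>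
    harc1 m K j hj d hd h0 σ hσpos hσinj W hWdef h
  choose F0 hF0fin hF0 using hA0
  choose F1 hF1fin hF1 using hA1
  let Fall : Set ℝ := (⋃ (j : Fin (K + 1)), ⋃ (hj : 2 ≤ (j : ℕ)), ⋃ (h : (j : ℕ) + 1 ≤ K + 1), F0 j hj h) ∪
    (⋃ (j : Fin (K + 1)), ⋃ (hj : 2 ≤ (j : ℕ)), ⋃ (h : (j : ℕ) + 1 ≤ K + 1), F1 j hj h)
  have hFall : Fall.Finite := by
    refine Set.Finite.union ?_ ?_
    · exact Set.finite_iUnion fun j => Set.finite_iUnion fun hj => Set.finite_iUnion fun h => hF0fin j hj h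
    · exact Set.finite_iUnion fun j => Set.finite_iUnion fun hj => Set.finite_iUnion fun h => hF1fin j hj h
  -- ONE shift: above the uniform-split threshold, above every witness entry, outside the exceptional shifts
  obtain ⟨C₀, hC₀, hsplit₀⟩ := exists_uniform_split_segment T W hT hW
  obtain ⟨C, hCgt, hCF⟩ := exists_gt_not_mem hFall (max C₀ (∑ l, ∑ i, σ l i))
  have hC₀C : C₀ ≤ C := le_of_lt (lt_of_le_of_lt (le_max_left _ _) hCgt)
  have hCpos : 0 < C := lt_of_lt_of_le hC₀ hC₀C
  have hσC : ∀ l i, σ l i < C := by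
    intro l i
    have h1 : σ l i ≤ ∑ i', σ l i' := Finset.single_le_sum (fun i' _ => (hσpos l i').le) (Finset.mem_univ i)
    have h2 : ∑ i', σ l i' ≤ ∑ l', ∑ i', σ l' i' :=
      Finset.single_le_sum (fun l' _ => Finset.sum_nonneg fun i' _ => (hσpos l' i').le) (Finset.mem_univ l)
    exact lt_of_le_of_lt (h1.trans h2) (lt_of_le_of_lt (le_max_right _ _) hCgt)
  have hsplit : ∀ ε : ℝ, 0 ≤ ε → ε ≤ 1 → ∀ l : Fin (K + 1),
      ∃ Y : Matrix (Fin m ⊕ Fin 0) (Fin m ⊕ Fin 0) ℝ, Y.det ≠ 0 ∧ ((1 - ε) • T + ε • W) l = Yᵀ * Y - C • (1 : Matrix (Fin m ⊕ Fin 0) (Fin m ⊕ Fin 0) ℝ) := by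
    intro ε h0ε h1ε l
    obtain ⟨Y, hY, hYeq⟩ := hsplit₀ C hC₀C ε h0ε h1ε l
    exact ⟨Y, hY, by rw [← hYeq]; rfl⟩
  -- the frame
  refine mem_closure_nodeFamilyPrime m K d T W hT hW C hCpos hsplit fun j hj h => ?_
  have hjK : j < K + 1 := by omega
  have hCF0 : C ∉ F0 j hj h := fun hmem => hCF (Or.inl (Set.mem_iUnion.2 ⟨⟨j, hjK⟩,
    Set.mem_iUnion.2 ⟨hj, Set.mem_iUnion.2 ⟨h, hmem⟩⟩⟩))
  have hCF1 : C ∉ F1 j hj h := fun hmem => hCF (Or.inr (Set.mem_iUnion.2 ⟨⟨j, hjK⟩,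
    Set.mem_iUnion.2 ⟨hj, Set.mem_iUnion.2 ⟨h, hmem⟩⟩⟩))
  -- the witness certificates at level `j + 1` (truncation along `Fin.castLE h`)
  have hdj : Function.Injective (fun l : Fin (j + 1) => d (Fin.castLE h l)) :=
    (hd.comp (Fin.strictMono_castLE h)).injective
  obtain ⟨-, ⟨Yw, hYw, hWsplit⟩, -, -, hnodes⟩ :=
    OsculationRecursion.node_certificates m j hj (fun l => d (Fin.castLE h l)) hdj (fun l => σ (Fin.castLE h l))
      (fun l i => hσpos _ i) (fun l i i' hii' => hσinj _ i i' hii') (fun l => W (Fin.castLE h l)) (fun _ => rfl)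
      C hCpos (fun i => hσC _ i)
  obtain ⟨hdetW₀, hresW₀, hnode₁⟩ := hnodes (fun l => d (Fin.castLE h (Fin.castSucc l)))
    (fun l => -(W (Fin.castLE h (Fin.castSucc l)))) (fun _ => rfl) (fun _ => rfl)
  obtain ⟨hdetW₁, hresW₁⟩ := hnode₁ Yw hYw hWsplit
    (fun l => (Yw⁻¹)ᵀ * (Fin.snoc (fun l => W (Fin.castLE h (Fin.castSucc l))) (-(C • (1 : Matrix (Fin m ⊕ Fin 0) (Fin m ⊕ Fin 0) ℝ))) :
      Fin (j + 1) → Matrix (Fin m ⊕ Fin 0) (Fin m ⊕ Fin 0) ℝ) l * Yw⁻¹) (fun _ => rfl)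
  have hdetW₁' := det_ne_zero_of_det_congr_ne_zero (Yw⁻¹) (fun l => d (Fin.castLE h l))
    (Fin.snoc (fun l => W (Fin.castLE h (Fin.castSucc l))) (-(C • (1 : Matrix (Fin m ⊕ Fin 0) (Fin m ⊕ Fin 0) ℝ))) : Fin (j + 1) → Matrix (Fin m ⊕ Fin 0) (Fin m ⊕ Fin 0) ℝ) hdetW₁
  -- the six cofinite providers
  obtain ⟨B₁, hB₁, hdet0⟩ := OsculationGeneric.det0_cofinite d T W h hdetW₀
  obtain ⟨B₂, hB₂, hfin0⟩ := OsculationUniform.fin0_cofinite m K j d T W h hresW₀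
  obtain ⟨B₃, hB₃, harc0'⟩ := hF0 j hj h C hCF0 hCpos hσC T hT
  obtain ⟨B₄, hB₄, hdet1⟩ := OsculationGeneric.det1_cofinite d T W h C hdetW₁'
  obtain ⟨B₅, hB₅, hfin1⟩ := OsculationUniform.fin1_cofinite m K j d T W h C Yw hYw hWsplit hresW₁
  obtain ⟨B₆, hB₆, harc1'⟩ := hF1 j hj h C hCF1 hCpos hσC T hT
  refine ⟨B₁ ∪ B₂ ∪ B₃ ∪ B₄ ∪ B₅ ∪ B₆,
    ((((hB₁.union hB₂).union hB₃).union hB₄).union hB₅).union hB₆, ?_⟩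
  intro ε _ _ hε Y hY hYsplit
  simp only [Set.mem_union, not_or] at hε
  obtain ⟨⟨⟨⟨⟨hε₁, hε₂⟩, hε₃⟩, hε₄⟩, hε₅⟩, hε₆⟩ := hε
  exact ⟨hdet0 ε hε₁, hfin0 ε hε₂, harc0' ε hε₃, hdet1 ε hε₄ Y hY, hfin1 ε hε₅ Y hY hYsplit,
    harc1' ε hε₆ Y hY hYsplit⟩

end Summit.ValiantsHypothesis.ValiantsHypothesis.Theorems.LacunarySymmetroidMatrixDescartes.GPDensity
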